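import Summits.ResolutionOfSingularities.ResolutionOfSingularities.Theorems.HilbertSamuelEliminationSigmaMaxModificationsCorridor3WLadderIsoTailsFormalFrameStep
import HarnessLib

/-!
# [OURS · L1 W4.2 · D14 «K1 FREE-RATIONAL TAILS»] The TOWER of formal frames: glue to the arc lemma (H6 (d)) and point matching (H6 (c))
# (D14-BRIDGE-CUT ROUTE H; crux `SigmaMaxModifications` stmt-ResolutionOfSingularities-18506 / conjunct stmt-…-19249; kernel
# `IsoQuadraticTowerTerminates p 3`, card C5 K1)

Lead prover res-L1-w42-lead-1 (gen 4), deal D14; sequel of `…Corridor3WLadderIsoTailsFormalFrameStep`. Helper file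
`--supports stmt-ResolutionOfSingularities-19249 --as helper`; kernel only, def-free, no named fact. OURS (cell res-hironaka, slot W4.2); NOT
statements of [Hironaka2017] nor of [CossartJannsenSaito2020] / [CossartPiltant2009]. AI-written; AI review is weaker than expert review.

## What is proved

* **`FormalFrame.mem_pow_of_frameTower` — H6 (d) GLUE.** A tower of rings `R n` with transitions `ι n`, frames `ψ n : R n → κ⟦t, y⟧`
  commuting with the transitions up to the translated chart substitution with constants `c (n+1)` (the output of `stepFrame`,
  `stepFrame_algebraMap_algebraMap`), `ψ n (t n) = t`, and strict transforms `ι n (h n) = (t (n+1))^m · h (n+1)` gives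
  `ψ 0 (h 0) ∈ (y₁ − Σ_k c_{k,1} t^k, y₂ − Σ_k c_{k,2} t^k, y₃ − Σ_k c_{k,3} t^k)^m` — the osculating arc lies in the multiplicity-`m` locus
  (via `Series.mem_pow_of_translatedStrictTransforms`, p521756).
* **POINT MATCHING (H6 (c))**: the prime `𝔔_c = stepPrime c hψt` seen by the frame is MAXIMAL for a frame with surjective residue map
  (`stepPrime_isMaximal`: the composite `R[𝔪/t] → κ⟦t,y⟧ → κ` is onto with kernel `𝔔_c`), contains `t` and the new coordinates
  `r_i/t − ã_i` as soon as `c_i = res(ψ ã_i) − λ_i` (`newCoord_mem_stepPrime`, `span_le_stepPrime`), hence EQUALS any maximal ideal of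
  the chart contained in it (`eq_stepPrime_of_isMaximal_of_le`) — the frame follows ANY prescribed `κ`-rational point of the `t`-chart
  (res-type-071's H5 presents the tower's point `x_{n+1}` as such a maximal ideal `(t, r_i/t − ã_i)`).

Remaining for H6 (lead-1, next): the BASE frame `ψ₀` (Cohen coordinates of the completed dimension-4 regular presentation ring, tree
`exists_ringEquiv_mvPowerSeries_residueField` / `comp_map_bijective` with the r.s.p. `(t, y)`), and the induction assembling `ψ n` along
res-type-071's embedded chart tower (H4 p521738 / H5) into the hypotheses of `mem_pow_of_frameTower`.

References: U. Görtz, T. Wedhorn, *Algebraic Geometry I* (2nd ed. 2020), (13.19) p. 415 [GortzWedhorn2020]; V. Cossart, O. Piltant,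
J. Algebra 321 (2009) ch. 3 I.9 [CossartPiltant2009]; idea-1 card C5 (Sketch d9de4647629be5a3).
-/

noncomputable section

set_option linter.dupNamespace false -- mandated namespace of this single-conjunct summit

open MvPowerSeries IsLocalRing
open Literature.AlgebraicGeometry.Resolution

namespace Summit.ResolutionOfSingularities.ResolutionOfSingularities.Cruxes.SigmaMaxModifications.IdeasL1C5

universe u

namespace FormalFrame

variable {κ : Type u} [Field κ]

/-! ### §1. The glue: a tower of frames along the strict transforms puts the arc in the multiplicity-`m` locus -/

/-- **H6 (d) GLUE — A TOWER OF FORMAL FRAMES GIVES THE OSCULATING ARC.** Rings `R n` (the local rings of the embedded free-rational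
chart tower), transition maps `ι n`, frames `ψ n : R n → κ⟦t, y⟧` commuting with the transitions up to the translated chart substitution with
constants `c (n+1)` (`stepFrame_algebraMap_algebraMap`), elements `t n` mapped to `t`, and strict transforms `h n` with
`ι n (h n) = (t (n+1))^m · h (n+1)`: then `ψ 0 (h 0) ∈ (y₁ − Σ_k c_{k,1} t^k, y₂ − Σ_k c_{k,2} t^k, y₃ − Σ_k c_{k,3} t^k)^m` in `κ⟦t, y⟧`
(`Series.mem_pow_of_translatedStrictTransforms`, p521756). [cite: CossartPiltant2009, ch. 3 I.9] -/
theorem mem_pow_of_frameTower {R : ℕ → Type u} [∀ n, CommRing (R n)] (ι : ∀ n, R n →+* R (n + 1))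
    (ψ : ∀ n, R n →+* MvPowerSeries (Fin 4) κ) (c : ℕ → Fin 4 → κ) (t : ∀ n, R n) (h : ∀ n, R n) (m : ℕ)
    (hcomm : ∀ n (x : R n), ψ (n + 1) (ι n x) = subst (Series.transChartSubst (c (n + 1))) (ψ n x))
    (ht : ∀ n, ψ n (t n) = X 0)
    (hstrict : ∀ n, ι n (h n) = t (n + 1) ^ m * h (n + 1)) :
    ψ 0 (h 0) ∈ (Ideal.span ({X 1 - Series.tSeries (fun k => c k 1), X 2 - Series.tSeries (fun k => c k 2),
      X 3 - Series.tSeries (fun k => c k 3)} : Set (MvPowerSeries (Fin 4) κ))) ^ m := by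
  refine Series.mem_pow_of_translatedStrictTransforms (ψ 0 (h 0)) m c (fun n => ψ n (h n)) rfl ?_
  intro j
  rw [← hcomm j (h j), hstrict j, map_mul, map_pow, ht]

/-! ### §2. Point matching: the prime seen by the frame is the prescribed `κ`-point of the `t`-chart -/

section PointMatching

variable {R : Type u} [CommRing R] [IsLocalRing R] {t : R} {ψ : R →+* MvPowerSeries (Fin 4) κ} [IsLocalHom ψ]
  (c : Fin 4 → κ) (hψt : ψ t = X 0)

/-- A point `r/t − ã` of the `t`-chart with `ψ r ≡ y_i + λ t (mod 𝔪²)` lies in `𝔔_c` as soon as `c_i + λ` is the residue of `ã`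
(`stepLift_newCoord_sub_mem_span`). [folklore] -/
theorem newCoord_mem_stepPrime {r : R} (hr : r ∈ maximalIdeal R) {i : Fin 4} (hi : i ≠ 0) {lam : κ}
    (hψr : ψ r - X i - C lam * X 0 ∈ maximalIdeal (MvPowerSeries (Fin 4) κ) ^ 2) {ct : R}
    (hct : ψ ct - C (c i + lam) ∈ maximalIdeal (MvPowerSeries (Fin 4) κ)) :
    (⟨_, div_mem_blowupAlgebra (maximalIdeal R) t hr⟩ - algebraMap R _ ct : blowupAlgebra (maximalIdeal R) t) ∈
      stepPrime c hψt := by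
  rw [Ideal.mem_comap]
  have h := stepLift_newCoord_sub_mem_span c hψt hr hi hψr hct
  have hX0 : Ideal.span {(X 0 : MvPowerSeries (Fin 4) κ)} ≤ maximalIdeal _ := by
    rw [Ideal.span_le, Set.singleton_subset_iff]; exact (mem_maximalIdeal_iff _).mpr (constantCoeff_X _)
  have hXi : (X i : MvPowerSeries (Fin 4) κ) ∈ maximalIdeal _ := (mem_maximalIdeal_iff _).mpr (constantCoeff_X _)
  have := Ideal.add_mem _ (hX0 h) hXi
  simpa using this

/-- The residue of `ã` determines the matching constant: `c_i := res(ψ ã) − λ` satisfies the hypothesis of `newCoord_mem_stepPrime`.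
[folklore] -/
theorem sub_C_constantCoeff_mem (f : MvPowerSeries (Fin 4) κ) : f - C (constantCoeff f) ∈ maximalIdeal (MvPowerSeries (Fin 4) κ) := by
  rw [mem_maximalIdeal_iff, map_sub, constantCoeff_C, sub_self]

/-- **𝔔_c IS MAXIMAL** (its residue ring embeds in `κ` and receives `R/𝔪 ↠ κ`), for a frame with surjective residue map. [folklore] -/
theorem stepPrime_isMaximal (hsurj : ∀ a : κ, ∃ x : R, ψ x - C a ∈ maximalIdeal (MvPowerSeries (Fin 4) κ)) :
    (stepPrime c hψt).IsMaximal := by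
  -- the composite `R[𝔪/t] → κ⟦t,y⟧ → κ` has kernel `𝔔_c` and is onto
  let ρ : blowupAlgebra (maximalIdeal R) t →+* κ := (constantCoeff).comp (stepLift t ψ c hψt)
  have hker : RingHom.ker ρ = stepPrime c hψt := by
    ext b
    rw [RingHom.mem_ker, Ideal.mem_comap, mem_maximalIdeal_iff]
    rfl
  have hsurjρ : Function.Surjective ρ := by
    intro a
    obtain ⟨x, hx⟩ := hsurj a
    refine ⟨algebraMap R _ x, ?_⟩
    change constantCoeff (stepLift t ψ c hψt (algebraMap R _ x)) = a
    rw [stepLift_algebraMap, substHom_apply]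
    have h1 : constantCoeff (subst (Series.transChartSubst c) (ψ x - C a)) = 0 :=
      constantCoeff_subst_eq_zero (Series.hasSubst_transChartSubst c)
        (fun i => by
          by_cases hi : i = 0
          · subst hi; rw [Series.transChartSubst_apply_zero, constantCoeff_X]
          · rw [Series.transChartSubst_apply_of_ne _ hi]; simp)
        ((mem_maximalIdeal_iff _).mp hx)
    rw [subst_sub (Series.hasSubst_transChartSubst c), subst_C, map_sub, constantCoeff_C, sub_eq_zero] at h1
    exact h1
  rw [← hker]
  exact RingHom.ker_isMaximal_of_surjective ρ hsurjρ

/-- **POINT MATCHING.** If `𝔪_R = (t, r₁, r₂, r₃)`, then for ANY elements `ã_i ∈ R` the `κ`-point `𝔑 = (t, r_i/t − ã_i)` of the `t`-chart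
IS the prime `𝔔_c` seen by the frame for the constants `c_i := res(ψ ã_i) − λ_i` — so the frame follows any prescribed free-rational step
(res-type-071's H5 presents the tower's point in exactly this form). [folklore] -/
theorem span_le_stepPrime {r : Fin 4 → R} (hr : ∀ i, i ≠ 0 → r i ∈ maximalIdeal R) {lam : Fin 4 → κ}
    (hψr : ∀ i, i ≠ 0 → ψ (r i) - X i - C (lam i) * X 0 ∈ maximalIdeal (MvPowerSeries (Fin 4) κ) ^ 2) (at_ : Fin 4 → R)
    (hc : ∀ i, i ≠ 0 → c i = constantCoeff (ψ (at_ i)) - lam i) :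
    ∀ i (hi : i ≠ 0), (⟨_, div_mem_blowupAlgebra (maximalIdeal R) t (hr i hi)⟩ - algebraMap R _ (at_ i) :
      blowupAlgebra (maximalIdeal R) t) ∈ stepPrime c hψt := by
  intro i hi
  refine newCoord_mem_stepPrime c hψt (hr i hi) hi (hψr i hi) ?_
  rw [hc i hi, sub_add_cancel]
  exact sub_C_constantCoeff_mem _

/-- Consequently any MAXIMAL ideal of `R[𝔪/t]` contained in `𝔔_c` — e.g. the point `(t, r_i/t − ã_i)` presented as a maximal ideal —
IS `𝔔_c`, and its localisation carries the frame `stepFrame c hψt`. [folklore] -/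
theorem eq_stepPrime_of_isMaximal_of_le {N : Ideal (blowupAlgebra (maximalIdeal R) t)} (hN : N.IsMaximal)
    (hle : N ≤ stepPrime c hψt) : N = stepPrime c hψt :=
  hN.eq_of_le (Ideal.IsPrime.ne_top inferInstance) hle

/-- `t ∈ 𝔔_c`, restated next to the point-matching lemmas. [folklore] -/
theorem t_mem_stepPrime : algebraMap R (blowupAlgebra (maximalIdeal R) t) t ∈ stepPrime c hψt :=
  algebraMap_t_mem_stepPrime c hψt

end PointMatching

end FormalFrame

end Summit.ResolutionOfSingularities.ResolutionOfSingularities.Cruxes.SigmaMaxModifications.IdeasL1C5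

end
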